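import Mathlib
import Summits.Langlands.Langlands.Theorems.PicardMuOrdinaryResidualAutomorphyOddPGL
import Summits.Langlands.Langlands.Theorems.PicardMuOrdinaryResidualAutomorphyOddCoeff
import Literature.NumberTheory.GaloisRepresentations.TateProjectiveLifting
import Literature.NumberTheory.GaloisRepresentations.ArtinRestriction
import HarnessLib

/-!
# The projective representation on the roots of a quartic and its lifts (helper for item stmt-Langlands-13759)

For an integer quartic `f` with four distinct roots in `ℚ̄`: the permutation representation
`permFin : Γ_ℚ → S₄` on an enumeration `rt` of the roots (`smul_rt`), its open kernel, the transfer
`12 ∣ #Gal(f) → 12 ∣ #permFin(Γ_ℚ)`, the projective representation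
`ρ̃ = (S₄ ≅ PGL₂(𝔽₃) ⊆ PGL₂(𝔽̄₃)) ∘ permFin` (`rhoTilde`, open kernel), the shape of any lift
`σ` of `ρ̃` (`exists_lift_entries`: `σ(γ) = c · g`, `g ∈ GL₂(𝔽₃)` inducing `permFin γ`; trace and
determinant), and ODDNESS of such a lift when not all roots of `f` are real (`isOdd_of_lift`: a
complex conjugation moves a root, so `σ(c)` is a non-scalar involution, of determinant `-1`).
-/

set_option linter.dupNamespace false -- project-wide option (lakefile weak.linter.dupNamespace); `Summit.Langlands.Langlands` is the mandated namespace

noncomputable section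

open scoped MatrixGroups Polynomial
open Polynomial NumberField Field IsDedekindDomain Literature.NumberTheory.GaloisRepresentations Matrix

namespace Summit.Langlands.Langlands.Theorems.ResidualAutomorphyOdd

local notation "Qbar" => AlgebraicClosure ℚ

/-! ### `ℚ̄` over `ℚ`

Mathlib's number-field library synthesises `DivisionRing.toRatAlgebra` as the `ℚ`-algebra structure
of `ℚ̄`, which agrees definitionally (not reducibly) with `AlgebraicClosure.instAlgebra ℚ`; the
structural instances are re-typed once along this identification (as in the tree's
`KroneckerWeberTheorem`). -/

/-- `ℚ̄/ℚ` is algebraic. -/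
theorem isAlgebraic_Qbar : Algebra.IsAlgebraic ℚ Qbar := AlgebraicClosure.isAlgebraic ℚ

/-- `ℚ̄/ℚ` is normal. -/
theorem normal_Qbar : Normal ℚ Qbar :=
  @IsAlgClosure.normal ℚ (AlgebraicClosure ℚ) _ _ (AlgebraicClosure.instAlgebra ℚ) inferInstance

attribute [local instance] isAlgebraic_Qbar normal_Qbar

/-! ### The roots of `f` in `ℚ̄` and the permutation representation -/

variable (f : ℤ[X])

/-- `f` over `ℚ`. -/
abbrev fQ : ℚ[X] := f.map (Int.castRingHom ℚ)

/-- `f` splits in `ℚ̄`. -/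
instance fact_splits_fQ : Fact (((fQ f).map (algebraMap ℚ Qbar)).Splits) := ⟨IsAlgClosed.splits _⟩

/-- The permutation action of `Γ_ℚ` on the roots of `f` in `ℚ̄`. -/
def permRoots : absoluteGaloisGroup ℚ →* Equiv.Perm ((fQ f).rootSet Qbar) :=
  (Polynomial.Gal.galActionHom (fQ f) Qbar).comp
    ((Polynomial.Gal.restrict (fQ f) Qbar).comp (absoluteGaloisGroup.toAlgEquiv ℚ).toMonoidHom)

/-- `permRoots` is the Galois action on `ℚ̄` restricted to the roots. -/
theorem coe_permRoots_apply (γ : absoluteGaloisGroup ℚ) (x : (fQ f).rootSet Qbar) :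
    ((permRoots f γ x : (fQ f).rootSet Qbar) : Qbar) = γ • (x : Qbar) := by
  simp only [permRoots, MonoidHom.coe_comp, Function.comp_apply]
  rw [Polynomial.Gal.galActionHom_restrict, absoluteGaloisGroup.smul_def]
  rfl

/-- The range of `permRoots` is in bijection with the Galois group of `f`. -/
theorem nat_card_range_permRoots : Nat.card (permRoots f).range = Nat.card (fQ f).Gal := by
  have hsurj : Function.Surjective
      ((Polynomial.Gal.restrict (fQ f) Qbar).comp (absoluteGaloisGroup.toAlgEquiv ℚ).toMonoidHom) := by
    simp only [MonoidHom.coe_comp]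
    exact (Polynomial.Gal.restrict_surjective (fQ f) Qbar).comp (absoluteGaloisGroup.toAlgEquiv ℚ).surjective
  have hrange : (permRoots f).range = (Polynomial.Gal.galActionHom (fQ f) Qbar).range := by
    rw [permRoots, MonoidHom.range_comp, MonoidHom.range_eq_top.2 hsurj, ← MonoidHom.range_eq_map]
  rw [hrange]
  exact Nat.card_congr
    (MonoidHom.ofInjective (Polynomial.Gal.galActionHom_injective (fQ f) Qbar)).symm.toEquiv

variable {f}
variable (hdeg : f.natDegree = 4) (hsep : (fQ f).Separable)

include hdeg hsep in
/-- A separable quartic has four roots in `ℚ̄`. -/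
theorem card_rootSet : Fintype.card ((fQ f).rootSet Qbar) = 4 := by
  rw [Polynomial.card_rootSet_eq_natDegree hsep (IsAlgClosed.splits _),
    Polynomial.natDegree_map_eq_of_injective Int.cast_injective, hdeg]

/-- An enumeration of the four roots. -/
def rootEnum : Fin 4 ≃ (fQ f).rootSet Qbar :=
  (Fintype.equivFinOfCardEq (card_rootSet hdeg hsep)).symm

/-- The permutation representation `Γ_ℚ → S₄` on the enumerated roots. -/
def permFin : absoluteGaloisGroup ℚ →* Equiv.Perm (Fin 4) :=
  ((rootEnum hdeg hsep).symm.permCongrHom).toMonoidHom.comp (permRoots f)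

/-- The enumerated roots as elements of `ℚ̄`. -/
def rt (i : Fin 4) : Qbar := (rootEnum hdeg hsep i : Qbar)

/-- The enumerated roots are distinct. -/
theorem rt_injective : Function.Injective (rt hdeg hsep) := fun _ _ h =>
  (rootEnum hdeg hsep).injective (Subtype.ext h)

/-- The enumerated roots are roots of `f`. -/
theorem aeval_rt (i : Fin 4) : aeval (rt hdeg hsep i) f = 0 := by
  have h := (Polynomial.mem_rootSet.1 (rootEnum hdeg hsep i).2).2
  have h' : aeval (rt hdeg hsep i) (f.map (algebraMap ℤ ℚ)) = 0 := by rwa [algebraMap_int_eq]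
  rwa [Polynomial.aeval_map_algebraMap] at h'

/-- `permFin` describes the Galois action on the enumerated roots. -/
theorem smul_rt (γ : absoluteGaloisGroup ℚ) (i : Fin 4) :
    γ • rt hdeg hsep i = rt hdeg hsep (permFin hdeg hsep γ i) := by
  have h : permFin hdeg hsep γ i = (rootEnum hdeg hsep).symm (permRoots f γ (rootEnum hdeg hsep i)) :=
    rfl
  rw [rt, rt, h, Equiv.apply_symm_apply, coe_permRoots_apply]

/-- `12 ∣ #Gal(f)` transfers to the image of `permFin`. -/
theorem twelve_dvd_card_range (hgal : 12 ∣ Nat.card (fQ f).Gal) :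
    12 ∣ Nat.card (permFin hdeg hsep).range := by
  have h : (permFin hdeg hsep).range = ((permRoots f).range).map
      ((rootEnum hdeg hsep).symm.permCongrHom).toMonoidHom := by
    rw [permFin, MonoidHom.range_comp]
  rw [h, Nat.card_congr (((permRoots f).range).equivMapOfInjective _
    ((rootEnum hdeg hsep).symm.permCongrHom).injective).toEquiv |>.symm, nat_card_range_permRoots]
  exact hgal

/-- Elements fixing the roots act trivially: the kernel of `permFin` is open. -/
theorem isOpen_ker_permFin : IsOpen ((permFin hdeg hsep).ker : Set (absoluteGaloisGroup ℚ)) := by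
  set L : IntermediateField ℚ Qbar := IntermediateField.adjoin ℚ ((fQ f).rootSet Qbar) with hL
  haveI : FiniteDimensional ℚ L :=
    IntermediateField.finiteDimensional_adjoin (fun x _ => (Algebra.IsAlgebraic.isAlgebraic x).isIntegral)
  apply Subgroup.isOpen_mono (H₁ := (L.fixingSubgroup : Subgroup (absoluteGaloisGroup ℚ))) ?_
    (IntermediateField.fixingSubgroup_isOpen L)
  intro γ hγ
  change permFin hdeg hsep γ = 1
  ext i : 1
  have hfix : γ • rt hdeg hsep i = rt hdeg hsep i := by
    have hmem : rt hdeg hsep i ∈ L := IntermediateField.subset_adjoin ℚ _ (rootEnum hdeg hsep i).2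
    exact (mem_fixingSubgroup_iff_forall_smul L γ).1 hγ ⟨_, hmem⟩
  have h2 : rt hdeg hsep (permFin hdeg hsep γ i) = rt hdeg hsep i := (smul_rt hdeg hsep γ i).symm.trans hfix
  rw [Equiv.Perm.one_apply]
  exact rt_injective hdeg hsep h2

/-! ### The projective representation `ρ̃ : Γ_ℚ → S₄ ≅ PGL₂(𝔽₃) ⊆ PGL₂(𝔽̄₃)` and its lifts -/

/-- `ρ̃ = (PGL₂(𝔽₃) ⊆ PGL₂(𝔽̄₃)) ∘ θ ∘ permFin`. -/
def rhoTilde : absoluteGaloisGroup ℚ →* PGL(2, K3) :=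
  (Matrix.ProjGenLinGroup.map castF3).comp (thetaPGL.toMonoidHom.comp (permFin hdeg hsep))

/-- Unfolding `rhoTilde`. -/
theorem rhoTilde_apply (γ : absoluteGaloisGroup ℚ) :
    rhoTilde hdeg hsep γ = Matrix.ProjGenLinGroup.map castF3 (thetaPGL (permFin hdeg hsep γ)) := rfl

/-- `ρ̃` has open kernel. -/
theorem isOpen_ker_rhoTilde : IsOpen ((rhoTilde hdeg hsep).ker : Set (absoluteGaloisGroup ℚ)) := by
  apply Subgroup.isOpen_mono (H₁ := (permFin hdeg hsep).ker) ?_ (isOpen_ker_permFin hdeg hsep)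
  intro γ hγ
  rw [MonoidHom.mem_ker] at hγ
  rw [MonoidHom.mem_ker, rhoTilde_apply, hγ, map_one, map_one]

variable {hdeg hsep}
variable {σ : FramedGaloisRep ℚ K3 2} (hσ : IsProjectiveLift (rhoTilde hdeg hsep) σ)

include hσ in
/-- **Shape of a lift.** Every `σ(γ)` is a non-zero scalar multiple of (the image in `GL₂(𝔽̄₃)` of) a
matrix `g ∈ GL₂(𝔽₃)` inducing the permutation `permFin γ` of the roots. -/
theorem exists_lift_entries (γ : absoluteGaloisGroup ℚ) :
    ∃ (g : GL (Fin 2) F3) (c : K3), c ≠ 0 ∧ permHom g = permFin hdeg hsep γ ∧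
      ((σ γ : GL (Fin 2) K3) : Matrix (Fin 2) (Fin 2) K3) =
        c • ((g : GL (Fin 2) F3) : Matrix (Fin 2) (Fin 2) F3).map castF3 := by
  obtain ⟨g, hg, hperm⟩ := exists_gl_of_perm (permFin hdeg hsep γ)
  have h1 : Matrix.ProjGenLinGroup.mk (Matrix.GeneralLinearGroup.map castF3 g) =
      Matrix.ProjGenLinGroup.mk (σ γ) := by
    rw [hσ γ, rhoTilde_apply, ← hg, Matrix.ProjGenLinGroup.map_mk]
  obtain ⟨u, hu⟩ := Matrix.ProjGenLinGroup.mk_eq_mk_iff.1 h1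
  refine ⟨g, (u : K3), u.ne_zero, hperm, ?_⟩
  rw [← hu, Units.val_mul, Matrix.GeneralLinearGroup.coe_scalar, Matrix.scalar_apply,
    ← Matrix.smul_eq_mul_diagonal]
  rfl

/-- Trace and determinant of `σ(γ)` in terms of the entries of `g`. -/
theorem trace_det_of_lift {γ : absoluteGaloisGroup ℚ} {g : GL (Fin 2) F3} {c : K3}
    (h : ((σ γ : GL (Fin 2) K3) : Matrix (Fin 2) (Fin 2) K3) =
      c • ((g : GL (Fin 2) F3) : Matrix (Fin 2) (Fin 2) F3).map castF3) :
    Matrix.trace ((σ γ : GL (Fin 2) K3) : Matrix (Fin 2) (Fin 2) K3) = c * castF3 (g 0 0 + g 1 1) ∧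
    Matrix.det ((σ γ : GL (Fin 2) K3) : Matrix (Fin 2) (Fin 2) K3) =
      c ^ 2 * castF3 (g 0 0 * g 1 1 - g 0 1 * g 1 0) := by
  constructor
  · rw [h, Matrix.trace_smul, Matrix.trace_fin_two, smul_eq_mul, map_add]
    rfl
  · rw [h, Matrix.det_smul, Matrix.det_fin_two, Fintype.card_fin, map_sub, map_mul, map_mul]
    rfl

/-! ### Oddness -/

include hdeg hsep in
/-- A complex conjugation moves some root (not all four roots of `f` are real). -/
theorem permFin_ne_one_of_isComplexConjugation (hreal : (f.map (Int.castRingHom ℝ)).roots.card ≠ 4)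
    {φ : ℚ →+* ℝ} {c : absoluteGaloisGroup ℚ} (hc : IsComplexConjugation φ c) :
    permFin hdeg hsep c ≠ 1 := by
  classical
  intro h1
  obtain ⟨ι, -, hι⟩ := isComplexConjugation_iff.1 hc
  -- every root is fixed by `c`, hence real under `ι`
  have hfix : ∀ i, c • rt hdeg hsep i = rt hdeg hsep i := by
    intro i; rw [smul_rt, h1, Equiv.Perm.one_apply]
  have hreal_i : ∀ i, ((ι (rt hdeg hsep i)).re : ℂ) = ι (rt hdeg hsep i) := by
    intro i
    rw [← Complex.conj_eq_iff_re, ← hι, hfix]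
  set x : Fin 4 → ℝ := fun i => (ι (rt hdeg hsep i)).re with hx
  have hxinj : Function.Injective x := by
    intro i j hij
    apply rt_injective hdeg hsep
    apply ι.injective
    have h := congrArg (fun t : ℝ => (t : ℂ)) hij
    simp only [hx] at h
    rwa [hreal_i, hreal_i] at h
  set fR := f.map (Int.castRingHom ℝ) with hfR
  have hf0 : f ≠ 0 := by rintro rfl; simp at hdeg
  have hfR0 : fR ≠ 0 := by
    rw [hfR, Ne, Polynomial.map_eq_zero_iff Int.cast_injective]; exact hf0
  have hroot : ∀ i, fR.eval (x i) = 0 := by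
    intro i
    have h0 := aeval_rt hdeg hsep i
    rw [aeval_def, RingHom.ext_int (algebraMap ℤ Qbar) (Int.castRingHom Qbar)] at h0
    apply Complex.ofReal_injective
    rw [Complex.ofReal_zero, hfR, eval_map, ← Complex.ofRealHom_eq_coe, hom_eval₂,
      RingHom.ext_int (Complex.ofRealHom.comp (Int.castRingHom ℝ)) (ι.comp (Int.castRingHom Qbar))]
    change f.eval₂ (ι.comp (Int.castRingHom Qbar)) ((x i : ℂ)) = 0
    rw [hreal_i, ← hom_eval₂, h0, map_zero]
  have hsub : Finset.univ.image x ⊆ fR.roots.toFinset := by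
    intro y hy
    obtain ⟨i, -, rfl⟩ := Finset.mem_image.1 hy
    rw [Multiset.mem_toFinset, mem_roots hfR0, IsRoot.def]
    exact hroot i
  have h4 : 4 ≤ fR.roots.toFinset.card := by
    calc 4 = (Finset.univ.image x).card := by rw [Finset.card_image_of_injective _ hxinj]; simp
      _ ≤ _ := Finset.card_le_card hsub
  have hle : fR.roots.card ≤ 4 := by
    calc fR.roots.card ≤ fR.natDegree := card_roots' fR
      _ ≤ f.natDegree := natDegree_map_le
      _ = 4 := hdeg
  have := Multiset.toFinset_card_le fR.roots
  omega

/-- An involution of `GL₂` which is not scalar has determinant `-1`. -/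
theorem det_eq_neg_one_of_mul_self {L : Type*} [Field L] {M : Matrix (Fin 2) (Fin 2) L}
    (hM : M * M = 1) (hns : ¬ (M 0 1 = 0 ∧ M 1 0 = 0 ∧ M 0 0 = M 1 1)) : M.det = -1 := by
  have h00 := congrFun (congrFun hM 0) 0
  have h01 := congrFun (congrFun hM 0) 1
  have h10 := congrFun (congrFun hM 1) 0
  have h11 := congrFun (congrFun hM 1) 1
  simp only [Matrix.mul_apply, Fin.sum_univ_two, Matrix.one_apply_eq, Matrix.one_apply_ne, ne_eq,
    zero_ne_one, one_ne_zero, not_false_eq_true] at h00 h01 h10 h11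
  rw [Matrix.det_fin_two]
  by_cases htr : M 0 0 + M 1 1 = 0
  · have hd : M 1 1 = -M 0 0 := by linear_combination htr
    rw [hd]
    linear_combination -h00
  · exfalso
    have hb : M 0 1 = 0 := by
      have : M 0 1 * (M 0 0 + M 1 1) = 0 := by linear_combination h01
      exact (mul_eq_zero.1 this).resolve_right htr
    have hc : M 1 0 = 0 := by
      have : M 1 0 * (M 0 0 + M 1 1) = 0 := by linear_combination h10
      exact (mul_eq_zero.1 this).resolve_right htr
    have had : M 0 0 ≠ M 1 1 := fun h => hns ⟨hb, hc, h⟩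
    have hprod : (M 0 0 - M 1 1) * (M 0 0 + M 1 1) = 0 := by
      rw [hb] at h00; rw [hc] at h11
      linear_combination h00 - h11
    rcases mul_eq_zero.1 hprod with h | h
    · exact had (sub_eq_zero.1 h)
    · exact htr h

include hσ in
/-- **Oddness.** A lift `σ` of `ρ̃` is odd when not all roots of `f` are real. -/
theorem isOdd_of_lift (hreal : (f.map (Int.castRingHom ℝ)).roots.card ≠ 4) : σ.IsOdd := by
  intro φ c hc
  obtain ⟨g, a, ha, hperm, hshape⟩ := exists_lift_entries hσ c
  have hne : permFin hdeg hsep c ≠ 1 := permFin_ne_one_of_isComplexConjugation hreal hc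
  -- `σ(c)` is a non-scalar involution
  set M := ((σ c : GL (Fin 2) K3) : Matrix (Fin 2) (Fin 2) K3) with hMdef
  have hMM : M * M = 1 := by
    rw [hMdef, ← Units.val_mul, ← map_mul, ← pow_two, hc.sq_eq_one, map_one, Units.val_one]
  have hns : ¬ (M 0 1 = 0 ∧ M 1 0 = 0 ∧ M 0 0 = M 1 1) := by
    rintro ⟨h01, h10, h0011⟩
    apply hne
    rw [← hperm, permHom_eq_one_iff, Matrix.GeneralLinearGroup.mem_center_iff_val_mem_range_scalar]
    have hinj : Function.Injective castF3 := (castF3).injective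
    have e01 : g 0 1 = 0 := by
      have h := h01; rw [hshape] at h
      simp only [Matrix.smul_apply, Matrix.map_apply, smul_eq_mul, mul_eq_zero, ha, false_or] at h
      exact hinj (by rw [h, map_zero])
    have e10 : g 1 0 = 0 := by
      have h := h10; rw [hshape] at h
      simp only [Matrix.smul_apply, Matrix.map_apply, smul_eq_mul, mul_eq_zero, ha, false_or] at h
      exact hinj (by rw [h, map_zero])
    have e0011 : g 0 0 = g 1 1 := by
      have h := h0011; rw [hshape] at h
      simp only [Matrix.smul_apply, Matrix.map_apply, smul_eq_mul] at h
      exact hinj (mul_left_cancel₀ ha h)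
    refine ⟨g 0 0, ?_⟩
    ext i j
    fin_cases i <;> fin_cases j <;> simp [Matrix.scalar_apply, Matrix.diagonal, e01, e10, e0011]
  have hdet := det_eq_neg_one_of_mul_self hMM hns
  apply Units.ext
  rw [Matrix.GeneralLinearGroup.val_det_apply, Units.val_neg, Units.val_one]
  exact hdet

end Summit.Langlands.Langlands.Theorems.ResidualAutomorphyOdd
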